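import Literature.AlgebraicGeometry.Modules.PullbackTensor
import Literature.AlgebraicGeometry.Modules.TensorUnitors
import HarnessLib

/-!
# The symmetry `M ⊗ N ≅ N ⊗ M` of the tensor product of `𝒪_X`-modules, its unitor and base-change compatibilities

The Stacks Project, Tag 01CA (Modules, §17.16), after Lemma 17.16.1: "there are functorial
isomorphisms `ℱ ⊗ 𝒢 = 𝒢 ⊗ ℱ`, `ℱ ⊗ 𝒪_X = ℱ` …". The tree's tensor product `Modules.tensorObj M N`
(`Modules/TensorProduct`) is the sheafification of Mathlib's presheaf tensor product, for which Mathlib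
(pin) provides the full SYMMETRIC MONOIDAL structure on presheaves of modules
(`PresheafOfModules.monoidalCategory`, `PresheafOfModules.symmetricCategory` in
`Mathlib/Algebra/Category/ModuleCat/Presheaf/Monoidal.lean`: pointwise `TensorProduct.comm`, with
`braiding_naturality`, `SymmetricCategory.symmetry`, `braiding_leftUnitor/rightUnitor`). This file
sheafifies the braiding — cited, not rebuilt:

* §1 **`tensorComm M N : M ⊗ N ≅ N ⊗ M`** (`(modulesSheafify X).mapIso (β_ M.val N.val)`), SYMMETRY
  `β_{M,N} ≫ β_{N,M} = 𝟙` (`tensorComm_hom_tensorComm_hom`, `tensorComm_inv`, `tensorComm_symm`),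
  NATURALITY `(f ⊗ g) ≫ β = β ≫ (g ⊗ f)` (`tensorMap_tensorComm_hom`), and the SECTION FORMULA
  **`β(s ⊗ t) = t ⊗ s`** on elementary tensors (`tensorComm_hom_app_tmulSection`, `_inv_`; the
  `tmulSection` of `Modules/PullbackTensor`);
* §2 UNITOR EXCHANGE `β_{E,𝒪} ≫ λ_E = ρ_E`, `β_{𝒪,E} ≫ ρ_E = λ_E` for the unit isomorphisms of
  `Modules/TensorUnitors` (`tensorComm_hom_tensorUnitLeftIso_hom`, `tensorComm_hom_tensorUnitRightIso_hom`);
* §3 BASE CHANGE: the lax structure of the direct image is symmetric,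
  `μ_{P,Q} ≫ f_*(β) = β ≫ μ_{Q,P}` (`pushforwardTensorHom_map_tensorComm_hom`), hence so is the
  comparison of `Modules/PullbackTensor`: **`f^*(β) ≫ θ_{N,M} = θ_{M,N} ≫ β`**
  (`pullback_map_tensorComm_hom_pullbackTensorHom`, and `…_pullbackTensorIso_hom` for vector bundles).

Everything is proved; no named facts, no instances (the isomorphisms are plain `def`s, no
`BraidedCategory X.Modules` instance — the tree has no `MonoidalCategory X.Modules`), no notation.
Not here: the ASSOCIATOR `(L ⊗ M) ⊗ N ≅ L ⊗ (M ⊗ N)` (needs "sheafification is monoidal",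
`(A ⊗_p B)^# ≅ (A^# ⊗_p B)^#`; separate file) and hence the hexagon. Use (Hodge programme, road №4,
crux 26512, library item (P2); consumers: Mukai's exchange rows, `detClass (M ⊗ N)` symmetry, (M4)(4c));
library only — proves nothing about 26512, №4, HC_AV or HC.

## References

* The Stacks Project, Tag 01CA (Modules, §17.16, Lemma 17.16.1 and the functorial isomorphisms after it;
  Lemma 17.16.4). [StacksProject]
* U. Görtz, T. Wedhorn, *Algebraic Geometry I*, 2nd ed. (2020), (7.4.8)–(7.8.2). [GortzWedhorn2020]
-/

noncomputable section

-- `TopCat.Presheaf`/`Scheme.Modules` are not reducible (as in Mathlib's `AlgebraicGeometry/Modules/Sheaf.lean`).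
set_option backward.isDefEq.respectTransparency false

open CategoryTheory AlgebraicGeometry Opposite TopologicalSpace MonoidalCategory BraidedCategory
open scoped TensorProduct

universe u

namespace Literature.AlgebraicGeometry.Modules

variable {X Y : Scheme.{u}}

/-! ### §1 The braiding -/

section Braiding

variable (M N : X.Modules)

/-- Mathlib's braiding `M(U) ⊗_{𝒪(U)} N(U) ≅ N(U) ⊗_{𝒪(U)} M(U)` of presheaves of modules
(`PresheafOfModules.symmetricCategory`), at the underlying presheaves of two `𝒪_X`-modules. [cite: StacksProject, Tag 01CA] -/
def presheafTensorComm : tensorPresheaf M N ≅ tensorPresheaf N M :=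
  β_ (toCommRingedPresheaf M) (toCommRingedPresheaf N)

/-- **The symmetry `M ⊗_{𝒪_X} N ≅ N ⊗_{𝒪_X} M`**: the braiding of presheaves of modules, sheafified
("`ℱ ⊗ 𝒢 = 𝒢 ⊗ ℱ` … functorial isomorphisms", Stacks 01CA). [cite: StacksProject, Tag 01CA (Lemma 17.16.1)] -/
def tensorComm : tensorObj M N ≅ tensorObj N M :=
  (modulesSheafify X).mapIso (presheafTensorComm M N)

/-- Unfolding. [cite: StacksProject, Tag 01CA] -/
theorem tensorComm_hom :
    (tensorComm M N).hom = (modulesSheafify X).map (presheafTensorComm M N).hom := rfl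

/-- **Symmetry**: `β_{M,N} ≫ β_{N,M} = 𝟙`. [cite: StacksProject, Tag 01CA (Lemma 17.16.1)] -/
@[reassoc]
theorem tensorComm_hom_tensorComm_hom : (tensorComm M N).hom ≫ (tensorComm N M).hom = 𝟙 _ := by
  rw [tensorComm_hom, tensorComm_hom, ← Functor.map_comp]
  have h : (presheafTensorComm M N).hom ≫ (presheafTensorComm N M).hom = 𝟙 _ :=
    SymmetricCategory.symmetry _ _
  rw [h, CategoryTheory.Functor.map_id]
  rfl

/-- The inverse of `β_{M,N}` is `β_{N,M}`. [cite: StacksProject, Tag 01CA (Lemma 17.16.1)] -/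
theorem tensorComm_inv : (tensorComm M N).inv = (tensorComm N M).hom := by
  rw [← cancel_epi (tensorComm M N).hom, Iso.hom_inv_id, tensorComm_hom_tensorComm_hom]

/-- `β_{M,N}.symm = β_{N,M}`. [cite: StacksProject, Tag 01CA (Lemma 17.16.1)] -/
theorem tensorComm_symm : (tensorComm M N).symm = tensorComm N M :=
  Iso.ext (tensorComm_inv M N)

variable {M N}

/-- **Naturality**: `(f ⊗ g) ≫ β = β ≫ (g ⊗ f)`. [cite: StacksProject, Tag 01CA (Lemma 17.16.1)] -/
@[reassoc]
theorem tensorMap_tensorComm_hom {M' N' : X.Modules} (f : M ⟶ M') (g : N ⟶ N') :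
    tensorMap f g ≫ (tensorComm M' N').hom = (tensorComm M N).hom ≫ tensorMap g f := by
  rw [tensorComm_hom, tensorComm_hom, tensorMap, tensorMap, ← Functor.map_comp, ← Functor.map_comp]
  exact congrArg _ (braiding_naturality (homToCommRingedPresheaf f) (homToCommRingedPresheaf g))

variable (M N)

/-- **`β(s ⊗ t) = t ⊗ s`** on elementary tensors. [cite: StacksProject, Tag 01CA (Lemma 17.16.1)] -/
theorem tensorComm_hom_app_tmulSection (U : X.Opens) (s : secMod M U) (t : secMod N U) :
    (tensorComm M N).hom.app U (tmulSection M N U s t) = tmulSection N M U t s := by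
  have h := congrArg (fun α => α.app (op U) (s ⊗ₜ[secRing X U] t))
    ((modulesSheafifyAdjunction X).unit.naturality (presheafTensorComm M N).hom)
  simp only [Functor.id_map, Functor.comp_map, PresheafOfModules.comp_app] at h
  exact h.symm

/-- `β⁻¹(t ⊗ s) = s ⊗ t`. [cite: StacksProject, Tag 01CA (Lemma 17.16.1)] -/
theorem tensorComm_inv_app_tmulSection (U : X.Opens) (s : secMod M U) (t : secMod N U) :
    (tensorComm M N).inv.app U (tmulSection N M U t s) = tmulSection M N U s t := by
  rw [tensorComm_inv]
  exact tensorComm_hom_app_tmulSection N M U t s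

/-! ### §2 Compatibility with the unitors -/

/-- **`β_{E,𝒪} ≫ λ_E = ρ_E`**: the symmetry exchanges the two unit isomorphisms of `Modules/TensorUnitors`
(Mathlib `braiding_leftUnitor`, sheafified). [cite: StacksProject, Tag 01CA (Lemma 17.16.1)] -/
theorem tensorComm_hom_tensorUnitLeftIso_hom (E : X.Modules) :
    (tensorComm E (SheafOfModules.unit X.ringCatSheaf)).hom ≫ (tensorUnitLeftIso E).hom =
      (tensorUnitRightIso E).hom := by
  rw [tensorComm_hom, tensorUnitLeftIso, tensorUnitRightIso, Iso.trans_hom, Iso.trans_hom,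
    Functor.mapIso_hom, Functor.mapIso_hom, ← Category.assoc, ← Functor.map_comp]
  congr 2
  exact braiding_leftUnitor (toCommRingedPresheaf E)

/-- **`β_{𝒪,E} ≫ ρ_E = λ_E`** (Mathlib `braiding_rightUnitor`, sheafified). [cite: StacksProject, Tag 01CA (Lemma 17.16.1)] -/
theorem tensorComm_hom_tensorUnitRightIso_hom (E : X.Modules) :
    (tensorComm (SheafOfModules.unit X.ringCatSheaf) E).hom ≫ (tensorUnitRightIso E).hom =
      (tensorUnitLeftIso E).hom := by
  rw [tensorComm_hom, tensorUnitLeftIso, tensorUnitRightIso, Iso.trans_hom, Iso.trans_hom,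
    Functor.mapIso_hom, Functor.mapIso_hom, ← Category.assoc, ← Functor.map_comp]
  congr 2
  exact braiding_rightUnitor (toCommRingedPresheaf E)

end Braiding

/-! ### §3 Compatibility with direct and inverse image -/

section Pullback

variable (f : X ⟶ Y)

/-- **The lax structure of `f_*` is symmetric**: `μ_{P,Q} ≫ f_*(β_{P,Q}) = β_{f_*P,f_*Q} ≫ μ_{Q,P}`
(both send `s ⊗ t` to `t ⊗ s`). [cite: StacksProject, Tag 01CA] -/
@[reassoc]
theorem pushforwardTensorHom_map_tensorComm_hom (P Q : X.Modules) :
    pushforwardTensorHom f P Q ≫ (Scheme.Modules.pushforward f).map (tensorComm P Q).hom =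
      (tensorComm ((Scheme.Modules.pushforward f).obj P) ((Scheme.Modules.pushforward f).obj Q)).hom ≫
        pushforwardTensorHom f Q P := by
  apply ((modulesSheafifyAdjunction Y).homEquiv _ _).injective
  rw [Adjunction.homEquiv_naturality_right, Adjunction.homEquiv_naturality_right, Adjunction.homEquiv_unit,
    Adjunction.homEquiv_unit,
    tensorComm_hom ((Scheme.Modules.pushforward f).obj P) ((Scheme.Modules.pushforward f).obj Q),
    (modulesSheafifyAdjunction Y).unit_naturality]
  change (tensorUnitHom _ _ ≫ (Scheme.Modules.toPresheafOfModules Y).map (pushforwardTensorHom f P Q)) ≫ _ =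
    (_ ≫ tensorUnitHom _ _) ≫ (Scheme.Modules.toPresheafOfModules Y).map (pushforwardTensorHom f Q P)
  rw [tensorUnitHom_comp_pushforwardTensorHom, Category.assoc, tensorUnitHom_comp_pushforwardTensorHom]
  ext V : 1
  apply ModuleCat.hom_ext
  apply TensorProduct.ext'
  intro s t
  exact tensorComm_hom_app_tmulSection P Q (f ⁻¹ᵁ V.unop) s t

/-- **The comparison `f^*(M ⊗ N) → f^*M ⊗ f^*N` is symmetric**: `f^*(β) ≫ θ_{N,M} = θ_{M,N} ≫ β`.
[cite: StacksProject, Tag 01CA (Lemma 17.16.4)] -/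
@[reassoc]
theorem pullback_map_tensorComm_hom_pullbackTensorHom (M N : Y.Modules) :
    (Scheme.Modules.pullback f).map (tensorComm M N).hom ≫ pullbackTensorHom f N M =
      pullbackTensorHom f M N ≫
        (tensorComm ((Scheme.Modules.pullback f).obj M) ((Scheme.Modules.pullback f).obj N)).hom := by
  apply ((Scheme.Modules.pullbackPushforwardAdjunction f).homEquiv _ _).injective
  rw [Adjunction.homEquiv_naturality_left, Adjunction.homEquiv_naturality_right, homEquiv_pullbackTensorHom,
    homEquiv_pullbackTensorHom, pullbackTensorTransposeHom_def, pullbackTensorTransposeHom_def,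
    Category.assoc, pushforwardTensorHom_map_tensorComm_hom, ← Category.assoc, ← Category.assoc,
    tensorMap_tensorComm_hom]

/-- The same for the isomorphism of `Modules/PullbackTensor` (vector bundles).
[cite: StacksProject, Tag 01CA (Lemma 17.16.4)] -/
@[reassoc]
theorem pullback_map_tensorComm_hom_pullbackTensorIso_hom {M N : Y.Modules}
    (hM : Motives.IsFiniteLocallyFree M) (hN : Motives.IsFiniteLocallyFree N) :
    (Scheme.Modules.pullback f).map (tensorComm M N).hom ≫ (pullbackTensorIso f hN hM).hom =
      (pullbackTensorIso f hM hN).hom ≫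
        (tensorComm ((Scheme.Modules.pullback f).obj M) ((Scheme.Modules.pullback f).obj N)).hom := by
  rw [pullbackTensorIso_hom, pullbackTensorIso_hom]
  exact pullback_map_tensorComm_hom_pullbackTensorHom f M N

end Pullback

end Literature.AlgebraicGeometry.Modules

end
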